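import Mathlib.Analysis.SpecialFunctions.OrdinaryHypergeometric
import Mathlib.Analysis.SpecialFunctions.Pow.Real
import Mathlib.Analysis.SpecialFunctions.Gamma.Basic
import Mathlib.MeasureTheory.Integral.IntervalIntegral.Basic
import HarnessLib

/-!
# Clausen's formula (square of a `₂F₁` as a `₃F₂`) and the iterated Euler integral (named facts)

Topic: `Literature/Analysis/SpecialFunctions`. Vendored by a grounder for route
`KontsevichZagierPeriods/KatzTower` (items stmt-KontsevichZagierPeriods-9884 `ClausenQuarterModPi`
and -9889 `ClausenQuarter`; also the value identity behind route RamanujanComposites'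
`ClausenLandenChain`, stmt-6746). Those route items assert that two explicit 2-dimensional integral
representations — the "product" box `∏_{i=0,1} zᵢ^{-3/4}(1-zᵢ)^{-1/4}(1-x₀zᵢ)^{-1/4}` on `(0,1)²`
and the "double Euler" box `2·(z₀z₁(1-z₀)(1-z₁)(1-x₀z₀z₁))^{-1/2}` on `(0,1)²` — are equivalent
under the Kontsevich–Zagier moves WITHOUT a value hypothesis; the equality of their VALUES is what
makes those items instances of the period conjecture, and it follows from the two printed results
recorded here together with Euler's integral representation, which is PROVED in the tree
(`Literature.NumberTheory.Automorphic.LegendreP.euler_integral_ordinaryHypergeometric`,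
= Andrews–Askey–Roy Thm 2.2.1). This file records, as named facts (`def … : Prop`, D-0014):

* `ClausenFormula` — T. Clausen (1828), as printed in Andrews–Askey–Roy, *Special Functions*
  (1999), Exercise 2.13 (p. 116) and eq. (7.4.6) (§7.4):
  `[₂F₁(a, b; a+b+½; x)]² = ₃F₂(2a, 2b, a+b; 2a+2b, a+b+½; x)`, as an identity of convergent power
  series on `|x| < 1` (real parameters; the printed formula carries no side condition — we add the
  non-degeneracy of the two lower parameters, without which neither side is defined);
* `EulerIntegralThreeFTwo` — the iterated Euler integral, Andrews–Askey–Roy eq. (2.2.2) in the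
  case `p = 2`, `q = 1`:
  `₃F₂(a₁, a₂, a₃; b₁, b₂; x) = Γ(b₂)/(Γ(a₃)Γ(b₂-a₃)) ∫₀¹ t^{a₃-1}(1-t)^{b₂-a₃-1} ₂F₁(a₁, a₂; b₁; xt) dt`
  "when `Re b_{q+1} > Re a_{p+1} > 0`", here for real parameters and real `|x| < 1`.

## How the route's value identity follows (for provers of KatzTower / RamanujanComposites)

For `0 < x < 1`:
`∫₀¹ t^{-3/4}(1-t)^{-1/4}(1-xt)^{-1/4} dt = Γ(¼)Γ(¾)/Γ(1) · ₂F₁(¼,¼;1;x) = π√2 · ₂F₁(¼,¼;1;x)`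
(tree theorem `euler_integral_ordinaryHypergeometric` with `a = b = ¼`, `c = 1`;
`Γ(¼)Γ(¾) = π / sin(π/4)`, Mathlib `Real.Gamma_mul_Gamma_one_sub`), so by Fubini the product box has
value `2π² · ₂F₁(¼,¼;1;x)²`. On the other side
`∫₀¹ s^{-1/2}(1-s)^{-1/2}(1-xts)^{-1/2} ds = π · ₂F₁(½,½;1;xt)` (same theorem, `a = b = ½`, `c = 1`)
and `∫₀¹ t^{-1/2}(1-t)^{-1/2} ₂F₁(½,½;1;xt) dt = Γ(½)²/Γ(1) · ₃F₂(½,½,½;1,1;x)`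
(`EulerIntegralThreeFTwo` with `a₃ = ½`, `b₂ = 1`), so the double-Euler box has value
`2π² · ₃F₂(½,½,½;1,1;x)`. `ClausenFormula` at `a = b = ¼` (`a+b+½ = 1`, `2a = 2b = a+b = ½`,
`2a+2b = 1`) reads `₂F₁(¼,¼;1;x)² = ₃F₂(½,½,½;1,1;x) = Σₙ ((½)ₙ/n!)³ xⁿ`; hence the two values agree.
Numerical check (grounder, series to 4000 terms; refuters' quadrature): both `19.99700…`,
`21.34883…`, `24.19950…` at `x = 0.1, 0.5, 0.9`.

## What is NOT here

No `ₚF_q` for general `p, q` (Mathlib has only `₂F₁ = ordinaryHypergeometric`); the `₃F₂` side is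
written as an explicit power series through `threeFTwoCoeff`. No proofs: both statements are named
facts to be used as hypotheses `(h : ClausenFormula)`; a discharge of `ClausenFormula` would follow
AAR Ex. 3.17(d) (equate coefficients via a terminating `₄F₃` evaluation) or Ex. 2.13 (both sides
solve the same third-order equation), and `EulerIntegralThreeFTwo` is termwise Beta integration
exactly as in the tree's proof of `euler_integral_ordinaryHypergeometric`. The specialised box
identity itself is deliberately NOT stated as a fact (it is a corollary, D-0026): consumers derive
it in their Theorems file from the two facts, the tree theorem and Fubini, as sketched above.
-/

noncomputable section

open scoped Real BigOperators

namespace Literature.Analysis.SpecialFunctions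

/-- The general coefficient of the generalised hypergeometric series
`₃F₂(a₁, a₂, a₃; b₁, b₂; x) = Σₙ (a₁)ₙ(a₂)ₙ(a₃)ₙ / ((b₁)ₙ(b₂)ₙ n!) · xⁿ` (rising factorials
`(a)ₙ = a(a+1)⋯(a+n-1)`, Mathlib's `ascPochhammer`), written like Mathlib's
`ordinaryHypergeometricCoefficient` with inverses (junk `0⁻¹ = 0` when a lower parameter is a
non-positive integer — excluded by hypothesis wherever the coefficient is used).
[cite: AndrewsAskeyRoy1999, (2.1.2)] -/
def threeFTwoCoeff (a₁ a₂ a₃ b₁ b₂ : ℝ) (n : ℕ) : ℝ :=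
  (n.factorial : ℝ)⁻¹ * (ascPochhammer ℝ n).eval a₁ * (ascPochhammer ℝ n).eval a₂ *
    (ascPochhammer ℝ n).eval a₃ * ((ascPochhammer ℝ n).eval b₁)⁻¹ * ((ascPochhammer ℝ n).eval b₂)⁻¹

/-- Sanity check of the normalisation: the constant coefficient is `1`. [folklore] -/
theorem threeFTwoCoeff_zero (a₁ a₂ a₃ b₁ b₂ : ℝ) : threeFTwoCoeff a₁ a₂ a₃ b₁ b₂ 0 = 1 := by
  simp [threeFTwoCoeff]

/-- **Clausen's formula (1828)**, as printed in Andrews–Askey–Roy, *Special Functions*,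
Exercise 2.13 (p. 116) and eq. (7.4.6):
`[₂F₁(a, b; a+b+½; x)]² = ₃F₂(2a, 2b, a+b; 2a+2b, a+b+½; x)`.
Stated for real parameters and real `|x| < 1` (where both series converge absolutely) as a
`HasSum` for the `₃F₂` series; the hypotheses exclude the poles of the lower parameters
`a+b+½` and `2a+2b` (non-positive integers), where the printed formula is not defined.
Grounds the VALUE side of `Summit.KontsevichZagierPeriods.KontsevichZagierPeriods.Theses.KatzTower.ClausenQuarterModPi`
/ `.ClausenQuarter` (case `a = b = 1/4`). [cite: AndrewsAskeyRoy1999, Ex. 2.13 (p. 116) and (7.4.6)] [cite: Clausen1828] -/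
def ClausenFormula : Prop :=
  ∀ (a b x : ℝ), |x| < 1 → (∀ n : ℕ, a + b + 1 / 2 ≠ -(n : ℝ)) → (∀ n : ℕ, 2 * a + 2 * b ≠ -(n : ℝ)) →
    HasSum (fun n : ℕ => threeFTwoCoeff (2 * a) (2 * b) (a + b) (2 * a + 2 * b) (a + b + 1 / 2) n * x ^ n)
      ((ordinaryHypergeometric (𝕂 := ℝ) a b (a + b + 1 / 2) x) ^ 2)

/-- **The iterated Euler integral for `₃F₂`**, Andrews–Askey–Roy eq. (2.2.2) with `p = 2`, `q = 1`
("integrating a `₂F₁` against the beta density adds a numerator parameter `a₃` and a denominator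
parameter `b₂`"): for real parameters with `b₂ > a₃ > 0`, `b₁ ∉ {0, -1, -2, …}` and real `|x| < 1`,
`₃F₂(a₁, a₂, a₃; b₁, b₂; x) = Γ(b₂)/(Γ(a₃)Γ(b₂-a₃)) · ∫₀¹ t^{a₃-1} (1-t)^{b₂-a₃-1} ₂F₁(a₁, a₂; b₁; xt) dt`,
the left side being the (absolutely convergent) `₃F₂` series, stated as a `HasSum`. The printed
condition is `Re b_{q+1} > Re a_{p+1} > 0` (convergence of the integral); `b₁ ∉ -ℕ` is implicit in
print (the `₂F₁` must be defined) and explicit here because Mathlib's coefficient takes the junk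
value `0⁻¹ = 0` there. Grounds the VALUE side of
`Summit.KontsevichZagierPeriods.KontsevichZagierPeriods.Theses.KatzTower.ClausenQuarter`
(case `a₁ = a₂ = a₃ = ½`, `b₁ = b₂ = 1`, combined with the tree's Euler integral).
[cite: AndrewsAskeyRoy1999, (2.2.2)] -/
def EulerIntegralThreeFTwo : Prop :=
  ∀ (a₁ a₂ a₃ b₁ b₂ x : ℝ), 0 < a₃ → a₃ < b₂ → (∀ n : ℕ, b₁ ≠ -(n : ℝ)) → |x| < 1 →
    HasSum (fun n : ℕ => threeFTwoCoeff a₁ a₂ a₃ b₁ b₂ n * x ^ n)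
      (Real.Gamma b₂ / (Real.Gamma a₃ * Real.Gamma (b₂ - a₃)) *
        ∫ t in (0 : ℝ)..1, t ^ (a₃ - 1) * (1 - t) ^ (b₂ - a₃ - 1) *
          ordinaryHypergeometric (𝕂 := ℝ) a₁ a₂ b₁ (x * t))

end Literature.Analysis.SpecialFunctions
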